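import Literature.AnabelianGeometry.EtaleTheta.SettingModelChiThetaCocycleSec
import Literature.AnabelianGeometry.EtaleTheta.SettingModelChiCensusClauses
import Literature.AnabelianGeometry.EtaleTheta.SettingModelChiThetaTopology
import Literature.AnabelianGeometry.EtaleTheta.SettingModel2InversionCoverings
import Literature.AnabelianGeometry.EtaleTheta.Discharge.Sec2InversionFixesDeltaTheta
import HarnessLib

/-!
# The χ-twisted root model of [EtTh] §1: the INVERSION fixes the model's étale theta class — GAP row G-L2t2-1
# (`hιη`) and the `E`-free inversion-datum binders of Prop. 2.14 (iii) HOLD at `modelχ` (R78 cluster, proof-only)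

Mochizuki, *The étale theta function …*, Publ. RIMS **45** (2009) [EtTh], Prop. 1.4 (ii) p. 22 ("`Θ̈(Ü⁻¹) = −Θ̈(Ü)`",
"`Θ̈(−Ü) = −Θ̈(Ü)`"), §2 p. 36 (the inversion `ι`), Prop. 2.2 (i) p. 37 ("acts on [`Δ̄_Θ`] by `+1`"), Thm. 1.6 (iii) p. 24
("the isomorphism of cohomology groups induced by `γ`") [cite: MochizukiEtTh2009, Prop 2.2 (i) p.37].  abc-iut cell,
layer L2, prover abc-iut-L2-d1 (gen 5); PROOF-ONLY (0 defs) over this seat's `SettingModelChiThetaCocycle(Sec)`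
(`thetaCocycleFunχ`, `etaDdχ`, `Huuχ`, `doubleUnderlineχSec`), abc-iut-L2-t1/abc-iut-w5-d249's twisted inversion
`twistedInversionTop (chi p)` of `Π^tp_X = Γ ⋊_χ G_{ℚ_p}` with its `modelχ` riders (abc-iut-L2-t10,
`SettingModelChiCensusClauses`: `twistedInversion_hinv_modelχ`, `map_deltaTemp_twistedInversion_modelχ`,
`toZ_twistedInversion_modelχ`), abc-iut-L2-t1's level law `levelHom_gfpInv = negXY` (`SettingModel2InversionCoverings`),
abc-iut-w5-d072's `thetaCompanionOfAut` (Thm. 1.6 (ii) companion `ι^Θ`), abc-iut-w4-d014's `+1`-on-`Δ_Θ` theorem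
(`Sec2InversionFixesDeltaTheta`) and abc-iut-L2-t1's `ThetaSetting.transport` (Thm. 1.6 (iii)).

GAP row **G-L2t2-1** asks for `hιη : ∃ τ ∈ C.Huu, transport c h E.etaDd = ContH1.conj … τ E.etaDd` («the inversion carries
`η̈^Θ` to a `Π^tp_X̲̲`-conjugate of itself»; by print `ι_*η̈^Θ ∈ {η̈^Θ, τ·η̈^Θ}`).  THIS FILE proves it at the INSTANCE
`D := modelχ p`, `E.etaDd := etaDdχ p` (the model's own theta class), `C.Huu := Huuχ p l`, `ι :=` the twisted inversion,
`c := thetaCompanionOfAut ι`, and supplies the other `E`-free binders of abc-iut-L2-t8's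
`rigidData_exists_monoIso_over_inversion` (Prop. 2.14 (iii) `{±1}`-part) at the model:
* `thm16i_twistedInversion_modelχ` — `ι(Π^tp_Ÿ) = Π^tp_Ÿ` (Thm. 1.6 (i) shape; levels `(x,y,z) ↦ (−x,−y,z)`);
* `map_Huuχ_twistedInversion` — `ι(Π^tp_X̲̲) = Π^tp_X̲̲`; `exists_restrict_twistedInversion_Huuχ` (the induced `φ`);
* `mem_GtpY_iff_twistedInversion_modelχ` (`hιY`), `aug_eq_one_iff_twistedInversion_modelχ` (`hιΔ`),
  `thetaIso_thetaCompanionOfAut_twistedInversion_eq_self` (`hβ`: `ι^Θ = +1` on `Δ_Θ`, from (R1e′));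
* **`transportFun_thetaCocycleχ_twistedInversion`** — the transport `ι^Θ ∘ f ∘ ι⁻¹` of the model's theta cocycle IS the
  cocycle, ON THE NOSE: `ι(inl γ) = inl(ι_Γ γ)` and both `centreRep (ι_Γ γ)`, `ι_Γ (centreRep γ)` have levels `(0,0,z_N(γ))`;
* **`transport_etaDdχ_twistedInversion`** (`ι_* η̈^Θ = η̈^Θ` for the model class) and **`hιη_modelχ`** (G-L2t2-1 with
  `τ := 1`), also in the exact consumer form `hιη_doubleUnderlineχSec`.
So, of the hypotheses of Prop. 2.14 (iii)'s inversion lift at the χ-model, only `h15 : Prop15iii` (EXPECTED-FALSE at stage 1,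
abc-iut-L2-t12; the stage-2 target) and the Cor. 2.18 (ii) input remain.  For the model class the printed `±`-ambiguity
collapses to `+` (no Kummer class of `−1` appears: the model's `η` is the pure `z`-coordinate).  SEMI-SYNTHETIC MODEL,
consistency evidence only; nothing of [EtTh] asserted; no side taken on [IUTchIII] Cor. 3.12.
-/

noncomputable section

namespace Literature.AnabelianGeometry.EtaleTheta.SettingModel

open Literature.AnabelianGeometry.SemiGraphs _root_.Function

variable (p : ℕ) [Fact p.Prime]

/-! ### Small bookkeeping on the twisted inversion of `Γ ⋊_χ G_{ℚ_p}` -/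

/-- `negXY (x, y, z) = (−x, −y, z)` (unfolding abc-iut-L2-t1's `Heis.negXY`). [cite: MochizukiEtTh2009, Prop 2.2 (i) p.37] -/
private theorem negXY_apply_aux {R : Type*} [CommRing R] (a : Heis R) : Heis.negXY a = ⟨-a.x, -a.y, a.z⟩ := rfl

/-- The inverse of the (involutive) topological inversion is itself. [cite: MochizukiEtTh2009, §2 p.36] -/
theorem twistedInversionTop_symm_apply (x : PiTpχ p) :
    (twistedInversionTop (chi p) (isInducing_leftRightχ p)).symm x = twistedInversion (chi p) x := by
  apply (twistedInversionTop (chi p) (isInducing_leftRightχ p)).injective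
  rw [ContinuousMulEquiv.apply_symm_apply, twistedInversionTop_apply, twistedInversion_twistedInversion]

/-- `Π^tp_{Y₂}` of the χ-model unfolded: `g ∈ YNχ p 2 ↔ g.left ∈ Δ^tp_{Y₂}` (`G_{K₂} = G_{ℚ_p}`). [cite: MochizukiEtTh2009, §1 p.17] -/
theorem mem_YNχ_two_iff (g : PiTpχ p) : g ∈ YNχ p 2 ↔ g.left ∈ dY 2 := by
  rw [YNχ, GfpTwistData.mem_YN, fieldKN_bot_qModel_two, IntermediateField.fixingSubgroup_bot]
  exact and_iff_left (Subgroup.mem_top _)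

/-- `ι(g) ∈ Π^tp_{Y₂} ↔ g ∈ Π^tp_{Y₂}` (`ι_Γ` preserves `Δ^tp_{Y_N}`, abc-iut-L2-t1's `gfpInv_mem_dY_iff`).
[cite: MochizukiEtTh2009, §1 p.17] -/
theorem twistedInversion_mem_YNχ_two_iff (g : PiTpχ p) :
    twistedInversion (chi p) g ∈ YNχ p 2 ↔ g ∈ YNχ p 2 := by
  rw [mem_YNχ_two_iff, mem_YNχ_two_iff, twistedInversion_left, gfpInv_mem_dY_iff]

/-- **`ι(Π^tp_Ÿ) = Π^tp_Ÿ` at the χ-model** (the Thm. 1.6 (i) clause `Thm16i` for the twisted inversion).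
[cite: MochizukiEtTh2009, Thm 1.6 (i) p.24] -/
theorem thm16i_twistedInversion_modelχ :
    ThetaSetting.Thm16i (Dα := ThetaSetting.modelχ p) (Dβ := ThetaSetting.modelχ p)
      (twistedInversionTop (chi p) (isInducing_leftRightχ p)) := by
  change (ThetaSetting.modelχ p).GtpYdd.map _ = (ThetaSetting.modelχ p).GtpYdd
  rw [GtpYdd_modelχ]
  ext g
  constructor
  · rintro ⟨h, hh, rfl⟩
    exact (twistedInversion_mem_YNχ_two_iff p h).mpr hh
  · intro hg
    refine ⟨twistedInversion (chi p) g, (twistedInversion_mem_YNχ_two_iff p g).mpr hg, ?_⟩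
    exact twistedInversion_twistedInversion (chi p) g

/-- `ι(g) ∈ Π^tp_X̲̲ ↔ g ∈ Π^tp_X̲̲` (`X̲̲ := Huuχ p l`: levels `x_l = 0`, `z_l = 0` are `negXY`-invariant).
[cite: MochizukiEtTh2009, Def 2.5 (i) p.39] -/
theorem twistedInversion_mem_Huuχ_iff (l : ℕ+) (g : PiTpχ p) :
    twistedInversion (chi p) g ∈ Huuχ p l ↔ g ∈ Huuχ p l := by
  rw [mem_Huuχ_iff, mem_Huuχ_iff, twistedInversion_left, levelHom_gfpInv, negXY_apply_aux]
  exact and_congr neg_eq_zero Iff.rfl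

/-- **`ι(Π^tp_X̲̲) = Π^tp_X̲̲` at the χ-model** (binder `hι`). [cite: MochizukiEtTh2009, Def 2.5 (i) p.39] -/
theorem map_Huuχ_twistedInversion (l : ℕ+) :
    (Huuχ p l).map (twistedInversionTop (chi p) (isInducing_leftRightχ p)).toMulEquiv.toMonoidHom = Huuχ p l := by
  ext g
  constructor
  · rintro ⟨h, hh, rfl⟩
    exact (twistedInversion_mem_Huuχ_iff p l h).mpr hh
  · intro hg
    refine ⟨twistedInversion (chi p) g, (twistedInversion_mem_Huuχ_iff p l g).mpr hg, ?_⟩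
    exact twistedInversion_twistedInversion (chi p) g

/-- The inversion restricted to `Π^tp_X̲̲` as a topological automorphism (binder `φ`, `hφ`).
[cite: MochizukiEtTh2009, Def 2.5 (i) p.39] -/
theorem exists_restrict_twistedInversion_Huuχ (l : ℕ+) :
    ∃ φ : ↥(Huuχ p l) ≃ₜ* ↥(Huuχ p l),
      ∀ x : Huuχ p l, ((φ x : Huuχ p l) : PiTpχ p) = twistedInversionTop (chi p) (isInducing_leftRightχ p) x := by
  refine ⟨{ toFun := fun x => ⟨twistedInversion (chi p) x, (twistedInversion_mem_Huuχ_iff p l _).mpr x.2⟩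
            invFun := fun x => ⟨twistedInversion (chi p) x, (twistedInversion_mem_Huuχ_iff p l _).mpr x.2⟩
            left_inv := fun x => Subtype.ext (twistedInversion_twistedInversion (chi p) x)
            right_inv := fun x => Subtype.ext (twistedInversion_twistedInversion (chi p) x)
            map_mul' := fun x y => Subtype.ext (map_mul (twistedInversion (chi p)) (x : PiTpχ p) (y : PiTpχ p))
            continuous_toFun := ((continuous_twistedInversion (chi p) (isInducing_leftRightχ p)).comp
              continuous_subtype_val).subtype_mk _
            continuous_invFun := ((continuous_twistedInversion (chi p) (isInducing_leftRightχ p)).comp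
              continuous_subtype_val).subtype_mk _ }, fun x => rfl⟩

/-- `hιY`: `x ∈ Π^tp_Y ↔ ι x ∈ Π^tp_Y` (`ι` reverses `Z`). [cite: MochizukiEtTh2009, §2 p.36] -/
theorem mem_GtpY_iff_twistedInversion_modelχ (x : PiTpχ p) :
    x ∈ (ThetaSetting.modelχ p).GtpY ↔
      twistedInversionTop (chi p) (isInducing_leftRightχ p) x ∈ (ThetaSetting.modelχ p).GtpY := by
  change (ThetaSetting.modelχ p).toZ x = 1 ↔ (ThetaSetting.modelχ p).toZ _ = 1
  rw [toZ_twistedInversion_modelχ, inv_eq_one]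

/-- `hιΔ`: `aug x = 1 ↔ aug (ι x) = 1` (`ι` is over `G_K`). [cite: Mochizuki2012, Rmk 1.4.1 (ii) p.28] -/
theorem aug_eq_one_iff_twistedInversion_modelχ (x : PiTpχ p) :
    (ThetaSetting.modelχ p).aug x = 1 ↔
      (ThetaSetting.modelχ p).aug (twistedInversionTop (chi p) (isInducing_leftRightχ p) x) = 1 := by
  rw [aug_twistedInversion_modelχ]

/-- **`hβ`: the theta companion `ι^Θ` of the twisted inversion is `+1` on `Δ_Θ`** at the χ-model (abc-iut-w4-d014's
theorem from (R1e′) `twistedInversion_hinv_modelχ`). [cite: MochizukiEtTh2009, Prop 2.2 (i) p.37] -/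
theorem thetaIso_thetaCompanionOfAut_twistedInversion_eq_self
    (a : (ThetaSetting.modelχ p).GtpTheta) (ha : a ∈ (ThetaSetting.modelχ p).DeltaTheta) :
    ((ThetaSetting.modelχ p).thetaCompanionOfAut (twistedInversionTop (chi p) (isInducing_leftRightχ p))
        (map_deltaTemp_twistedInversion_modelχ p) (isQuotientMap_toTheta_modelχ p)).thetaIso a = a :=
  ThetaSetting.ThetaCompanion.thetaIso_apply_eq_self_of_inversion (ThetaSetting.modelχ p)
    (twistedInversion_hinv_modelχ p) _ a ha

/-! ### The inversion fixes the model's theta cocycle -/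

/-- **The transport `ι^Θ ∘ f ∘ ι⁻¹` (Thm. 1.6 (iii)) of the model's theta cocycle along the twisted inversion IS the
cocycle**: `ι^Θ(toTheta(inl(centreRep (ι x).left))) = toTheta(inl(ι_Γ(centreRep(ι_Γ x.left))))` and the levels of
`ι_Γ ∘ centreRep ∘ ι_Γ` and `centreRep` agree on `Ker pr₂` (`negXY (0,0,z) = (0,0,z)`). [cite: MochizukiEtTh2009, Thm 1.6 (iii) p.24] -/
theorem transportFun_thetaCocycleχ_twistedInversion :
    ThetaSetting.transportFun
        ((ThetaSetting.modelχ p).thetaCompanionOfAut (twistedInversionTop (chi p) (isInducing_leftRightχ p))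
          (map_deltaTemp_twistedInversion_modelχ p) (isQuotientMap_toTheta_modelχ p))
        (thm16i_twistedInversion_modelχ p)
        (fun g : ↥(ThetaSetting.modelχ p).GtpYdd =>
          thetaCocycleFunχ p ⟨g, (ThetaSetting.modelχ p).GtpYdd_le_GtpY g.2⟩) =
      fun g : ↥(ThetaSetting.modelχ p).GtpYdd => thetaCocycleFunχ p ⟨g, (ThetaSetting.modelχ p).GtpYdd_le_GtpY g.2⟩ := by
  funext x
  apply Subtype.ext
  have hx : (x : PiTpχ p).left ∈ gfpSnd.ker :=
    left_mem_ker_of_mem_GtpY ((ThetaSetting.modelχ p).GtpYdd_le_GtpY x.2)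
  have hx' : gfpInv (x : PiTpχ p).left ∈ gfpSnd.ker := by
    rw [MonoidHom.mem_ker, gfpSnd_gfpInv, inv_eq_one]; exact hx
  change (((ThetaSetting.modelχ p).thetaCompanionOfAut (twistedInversionTop (chi p) (isInducing_leftRightχ p))
      (map_deltaTemp_twistedInversion_modelχ p) (isQuotientMap_toTheta_modelχ p)).thetaIso
        (CurveTheta.toTheta (curveχ p) (SemidirectProduct.inl (centreRep
          ((twistedInversionTop (chi p) (isInducing_leftRightχ p)).symm (x : PiTpχ p)).left))) : _) =
    CurveTheta.toTheta (curveχ p) (SemidirectProduct.inl (centreRep (x : PiTpχ p).left))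
  rw [twistedInversionTop_symm_apply, twistedInversion_left]
  erw [ThetaSetting.thetaCompanionOfAut_thetaIso_toTheta]
  change CurveTheta.toTheta (curveχ p) (twistedInversion (chi p)
      (SemidirectProduct.inl (centreRep (gfpInv (x : PiTpχ p).left)))) = _
  rw [twistedInversion_inl]
  refine toTheta_eq_of_right_eq_one p _ _ (SemidirectProduct.right_inl _) (SemidirectProduct.right_inl _) ?_
  rw [mem_closure_commutator₃_iff_forall_hHat]
  intro N
  rw [SemidirectProduct.left_inl, SemidirectProduct.left_inl, map_mul, map_inv]
  change levelHom N (gfpInv (centreRep (gfpInv (x : PiTpχ p).left))) * (levelHom N (centreRep (x : PiTpχ p).left))⁻¹ = 1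
  rw [levelHom_gfpInv, levelHom_centreRep N hx', levelHom_centreRep N hx, levelHom_gfpInv, negXY_apply_aux,
    negXY_apply_aux, mul_inv_eq_one]
  ext <;> simp

/-- **`ι_* η̈^Θ = η̈^Θ` for the model's theta class**: the transport (Thm. 1.6 (iii)) along the twisted inversion and
its theta companion fixes `etaDdχ`. [cite: MochizukiEtTh2009, Thm 1.6 (iii) p.24] -/
theorem transport_etaDdχ_twistedInversion :
    ThetaSetting.transport
        ((ThetaSetting.modelχ p).thetaCompanionOfAut (twistedInversionTop (chi p) (isInducing_leftRightχ p))
          (map_deltaTemp_twistedInversion_modelχ p) (isQuotientMap_toTheta_modelχ p))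
        (thm16i_twistedInversion_modelχ p) (etaDdχ p) = etaDdχ p := by
  rw [etaDdχ_eq_mk]
  change ContH1.mk (ThetaSetting.transportFun _ _ _) _ = ContH1.mk _ _
  congr 1
  exact transportFun_thetaCocycleχ_twistedInversion p

/-- **GAP row G-L2t2-1 (`hιη`) HOLDS at the χ-model for the model class**, with `τ := 1 ∈ Π^tp_X̲̲`: the inversion
carries `η̈^Θ` to (the trivial) `Π^tp_X̲̲`-conjugate of itself. [cite: MochizukiEtTh2009, Prop 1.4 (ii) p.22] -/
theorem hιη_modelχ (l : ℕ+) (hC : (ThetaSetting.modelχ p).Compat) :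
    haveI := hC.GtpYdd_normal
    ∃ τ ∈ Huuχ p l, ThetaSetting.transport
        ((ThetaSetting.modelχ p).thetaCompanionOfAut (twistedInversionTop (chi p) (isInducing_leftRightχ p))
          (map_deltaTemp_twistedInversion_modelχ p) (isQuotientMap_toTheta_modelχ p))
        (thm16i_twistedInversion_modelχ p) (etaDdχ p) =
      ContH1.conj (ThetaSetting.modelχ p).toTheta (ThetaSetting.modelχ p).DeltaTheta τ (etaDdχ p) := by
  haveI := hC.GtpYdd_normal
  refine ⟨1, Subgroup.one_mem _, ?_⟩
  rw [transport_etaDdχ_twistedInversion, ContH1.conj_eq_self_of_mem _ (Subgroup.one_mem _)]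

/-- **`hιη` in the exact consumer form** of abc-iut-L2-t8's `rigidData_exists_monoIso_over_inversion`, at
`E := etaleThetaDataχSec p (etaDdχ p)` (abc-iut-L2-t6's section datum carrying the model class) and
`C := doubleUnderlineχSec p l hl` (`C.Huu = Huuχ p l`). [cite: MochizukiEtTh2009, Prop 1.4 (ii) p.22] -/
theorem hιη_doubleUnderlineχSec (l : ℕ+) (hl : Odd (l : ℕ)) (hC : (ThetaSetting.modelχ p).Compat) :
    haveI := hC.GtpYdd_normal
    ∃ τ ∈ (doubleUnderlineχSec p l hl).Huu, ThetaSetting.transport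
        ((ThetaSetting.modelχ p).thetaCompanionOfAut (twistedInversionTop (chi p) (isInducing_leftRightχ p))
          (map_deltaTemp_twistedInversion_modelχ p) (isQuotientMap_toTheta_modelχ p))
        (thm16i_twistedInversion_modelχ p) (etaleThetaDataχSec p (etaDdχ p)).etaDd =
      ContH1.conj (ThetaSetting.modelχ p).toTheta (ThetaSetting.modelχ p).DeltaTheta τ
        (etaleThetaDataχSec p (etaDdχ p)).etaDd :=
  hιη_modelχ p l hC

/-- `ι(Π^tp_X̲̲) = Π^tp_X̲̲` in the consumer form (`C := doubleUnderlineχSec`). [cite: MochizukiEtTh2009, Def 2.5 (i) p.39] -/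
theorem map_Huu_doubleUnderlineχSec_twistedInversion (l : ℕ+) (hl : Odd (l : ℕ)) :
    (doubleUnderlineχSec p l hl).Huu.map (twistedInversionTop (chi p) (isInducing_leftRightχ p)).toMulEquiv.toMonoidHom =
      (doubleUnderlineχSec p l hl).Huu :=
  map_Huuχ_twistedInversion p l

end Literature.AnabelianGeometry.EtaleTheta.SettingModel

end
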